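import Literature.Claims.NS.Dodge2026
import Summits.NavierStokesRegularity.NavierStokesRegularity.Theorems.SoloRefuteDodge2026Fields
import Literature.Analysis.FunctionSpaces.Complexify
import Mathlib.Analysis.Fourier.FourierTransform
import HarnessLib

/-!
# C162 `Dodge2026` — refuter kit (ns-claims-refuter-1 g4): Lemma 3 is false

Text of record: Dodge, *Global Regularity of 3D Incompressible Navier–Stokes via Scale-Dependent Geometric
Decoherence*, Zenodo 21515457 (7 pp.), skeleton `Literature.Claims.NS.Dodge2026` (ns-claims-typist-6 g6).
Kernel object: `not_Step4a_L3support : ¬ Step4a_L3support` — Lemma 3 p.4 l.26–29 at the printed (field-level)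
grain («Let u be a divergence-free velocity field with ‖ω‖_{L∞} = M … supp(ω̂) ∩ {|k| ≥ (M/ν)^{1/2}} ≠ ∅»)
fails for the band-limited divergence-free Schwartz field `ub` of `SoloRefuteDodge2026Fields` at `ν = M`:
`supp ω̂ ⊆ {|k|² ≤ 1/2}` while `(M/ν)^{1/2} = 1`. Ingredients here: the complexified vector Fourier integral
`vortHat ub` computed componentwise (`vortHat_ub_apply`), its closed support (`tsupport_vortHat_ub_subset`),
`M = sup ‖ω‖` as an `IsLUB` with `0 < M` (`isLUB_Msup`, `Msup_pos`), rapid decay of `ub`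
(`hasRapidSpatialDecay_ub`). Lettering / class are the chair's (VERDICT line on the cell bus). [folklore]

WHAT THIS IS NOT: not a claim about NS regularity or blow-up; not a claim about any author beyond the
typed locator.
-/

set_option linter.dupNamespace false

noncomputable section

open MeasureTheory SchwartzMap FourierTransform Real Set
open scoped FourierTransform RealInnerProductSpace ContDiff

namespace Summit.NavierStokesRegularity.NavierStokesRegularity.Theorems.Dodge2026

open Literature.Analysis.FluidPDE

/-! ### The complexified Fourier integral `ω̂` of the countermodel vanishes off the ball `‖ξ‖² < 1/2` -/

/-- the standard basis vectors of `ℂ³` -/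
def cvec (i : Fin 3) : EuclideanSpace ℂ (Fin 3) := EuclideanSpace.single i 1

/-- `complexify ω(x) = Σᵢ ωᵢ(x) eᵢ` with the complex Schwartz components `vortC i`. [folklore] -/
theorem complexify_curl_ub (x : E3) :
    Literature.Analysis.FunctionSpaces.EuclideanSpace.complexify (curl ub x) = ∑ i, (vortC i x) • cvec i := by
  ext j
  rw [Literature.Analysis.FunctionSpaces.EuclideanSpace.complexify_apply, curl_ub_ofReal]
  simp [cvec, PiLp.single_apply, Fin.sum_univ_three]
  fin_cases j <;> simp

/-- `𝓕 (vortC i) = 0` off the ball `‖ξ‖² < 1/2`. [folklore] -/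
theorem fourier_vortC_eq_zero (i : Fin 3) {ξ : E3} (hξ : 1 / 2 ≤ ‖ξ‖ ^ 2) :
    𝓕 (vortC i : E3 → ℂ) ξ = 0 := by
  rw [← curl_ub_ofReal_fun]; exact fourier_vort_eq_zero i hξ

/-- the vector Fourier integral `ω̂(ξ)` of the countermodel, componentwise. [folklore] -/
theorem vortHat_ub_apply (ξ : E3) :
    Literature.Claims.NS.Dodge2026.vortHat ub ξ = ∑ i, (𝓕 (vortC i : E3 → ℂ) ξ) • cvec i := by
  unfold Literature.Claims.NS.Dodge2026.vortHat
  rw [Real.fourier_eq]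
  have hint : ∀ i : Fin 3, Integrable (fun v : E3 => 𝐞 (-⟪v, ξ⟫) • (vortC i v)) :=
    fun i => (Real.fourierIntegral_convergent_iff ξ).2 (vortC i).integrable
  have hfun : (fun v : E3 => 𝐞 (-⟪v, ξ⟫) •
      (Literature.Analysis.FunctionSpaces.EuclideanSpace.complexify (curl ub v) : EuclideanSpace ℂ (Fin 3)))
      = fun v => ∑ i, (𝐞 (-⟪v, ξ⟫) • vortC i v) • cvec i := by
    funext v
    rw [complexify_curl_ub, Finset.smul_sum]
    refine Finset.sum_congr rfl fun i _ => ?_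
    rw [Circle.smul_def, Circle.smul_def, smul_smul, smul_eq_mul]
  rw [hfun, integral_finsetSum _ fun i _ => (hint i).smul_const (cvec i)]
  refine Finset.sum_congr rfl fun i _ => ?_
  rw [integral_smul_const, Real.fourier_eq]

/-- **Band limitation**: `ω̂(ξ) = 0` whenever `‖ξ‖² ≥ 1/2`. [folklore] -/
theorem vortHat_ub_eq_zero {ξ : E3} (hξ : 1 / 2 ≤ ‖ξ‖ ^ 2) :
    Literature.Claims.NS.Dodge2026.vortHat ub ξ = 0 := by
  rw [vortHat_ub_apply]
  exact Finset.sum_eq_zero fun i _ => by rw [fourier_vortC_eq_zero i hξ, zero_smul]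

/-- hence the closed support of `ω̂` lies in the ball `‖ξ‖² ≤ 1/2`. [folklore] -/
theorem tsupport_vortHat_ub_subset :
    tsupport (Literature.Claims.NS.Dodge2026.vortHat ub) ⊆ {ξ : E3 | ‖ξ‖ ^ 2 ≤ 1 / 2} := by
  apply closure_minimal
  · intro ξ hξ
    rw [Function.mem_support] at hξ
    by_contra h
    simp only [Set.mem_setOf_eq, not_le] at h
    exact hξ (vortHat_ub_eq_zero h.le)
  · exact isClosed_le (continuous_norm.pow 2) continuous_const

/-! ### `M = ‖ω‖_{L∞}` of the countermodel: a positive least upper bound -/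

/-- `M = sup_x ‖ω(x)‖`. -/
def Msup : ℝ := sSup (Set.range fun x => ‖curl ub x‖)

/-- `M` is the least upper bound of `‖ω‖` (bounded range). [folklore] -/
theorem isLUB_Msup : IsLUB (Set.range fun x => ‖curl ub x‖) Msup := by
  obtain ⟨C, hC⟩ := curl_ub_bounded
  exact isLUB_csSup (Set.range_nonempty _) ⟨C, by rintro _ ⟨x, rfl⟩; exact hC x⟩

/-- `0 < M` (the vorticity does not vanish at the origin). [folklore] -/
theorem Msup_pos : 0 < Msup :=
  lt_of_lt_of_le (norm_pos_iff.2 curl_ub_zero_ne) (isLUB_Msup.1 ⟨0, rfl⟩)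

/-- the countermodel has Fefferman's rapid decay (4) (it is a Schwartz map). [folklore] -/
theorem hasRapidSpatialDecay_ub : HasRapidSpatialDecay ub := fun n K =>
  ⟨2 ^ K * (Finset.Iic (K, n)).sup (fun m => SchwartzMap.seminorm ℝ m.1 m.2) ubS,
    fun x => SchwartzMap.one_add_le_sup_seminorm_apply (𝕜 := ℝ) (m := (K, n)) le_rfl le_rfl ubS x⟩

/-! ### The refutation -/

/-- **Refutes `Literature.Claims.NS.Dodge2026.Step4a_L3support` [refuted-substantive]** — Lemma 3 of the
text of record, p.4 l.26–29 («Let u be a divergence-free velocity field with ‖ω‖_{L∞} = M. By the standard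
Bernstein inequality for the Laplacian in L∞(ℝ³), the high-frequency support of the vorticity field must
satisfy supp(ω̂) ∩ {|k| ≥ (M/ν)^{1/2}} ≠ ∅»), is FALSE: the divergence-free Schwartz field
`ub = (∂₁ψ, −∂₀ψ, 0)`, `ψ = 𝓕⁻¹[smoothTransition (2 − 4|k|²)]`, has `ω̂` supported in `|k|² ≤ 1/2` and
`M = ‖ω‖_{L∞} > 0`; at `ν = M` the set `{|k| ≥ (M/ν)^{1/2} = 1}` misses `supp ω̂`. (Bernstein's inequality
bounds `‖Δg‖_∞ ≲ R²‖g‖_∞` for `supp ĝ ⊆ {|k| ≤ R}`; it forces no frequency `≥ (M/ν)^{1/2}` — the amplitude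
`M` and the frequency scale are independent for a field at a fixed time.) No cheap repair: demanding it only
along Navier–Stokes solutions at blow-up times is the posited Step 4b, a statement about the undefined
«dominant frequency j». WHAT THIS IS NOT: not a claim about NS regularity or blow-up; not a claim about any
author beyond the typed locator. [folklore] -/
theorem not_Step4a_L3support : ¬ Literature.Claims.NS.Dodge2026.Step4a_L3support := by
  intro h
  obtain ⟨ξ, hξ1, hξ2⟩ :=
    h Msup Msup_pos ub ub_contDiff isDivFree_ub hasRapidSpatialDecay_ub Msup Msup_pos isLUB_Msup
  have h1 : ‖ξ‖ ^ 2 ≤ 1 / 2 := tsupport_vortHat_ub_subset hξ1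
  have h2 : Real.sqrt (Msup / Msup) ≤ ‖ξ‖ := hξ2
  rw [div_self Msup_pos.ne', Real.sqrt_one] at h2
  nlinarith

/-- FQN guard: the headline's type is literally `¬` the skeleton's decl. -/
example : ¬ Literature.Claims.NS.Dodge2026.Step4a_L3support := not_Step4a_L3support

end Summit.NavierStokesRegularity.NavierStokesRegularity.Theorems.Dodge2026
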